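import Literature.Barriers.RiemannHypothesis.TuranPartialSumsSmoothedCesaro
import Literature.Analysis.SpecialFunctions.DigammaLogBound
import Literature.NumberTheory.LFunctions.RiemannXiOrderProofs
import Mathlib.Analysis.Complex.Liouville
import Mathlib.NumberTheory.LSeries.Deriv
import HarnessLib

/-!
# Montgomery 1983 for the Abel means `A_N`: twisted zeros beyond `1 + c log log N/log N`

Proofs-only companion of `Literature/Barriers/RiemannHypothesis/TuranPartialSums.lean` (named fact
`Literature.Barriers.RiemannHypothesis.montgomery1983_smoothedRemark`, Montgomery 1983, §1 p. 498: "our proof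
of the Theorem, mutatis mutandis, applies to these functions [`C_N`, `V_N`, `A_N`] as well"). Two auxiliary
definitions (the Abel-smoothed twisted series and its frozen kernel factor; concrete functions), no named
facts.

For Montgomery's twist `a = montgomeryTwist m` and `P_N(s) = Σ_n e^{−n/N} a(n) n^{−s}`:

* elementary facts on `Γ` in the strip `0 < Re w ≤ 2` (`|Γ| ≤ 4` for `Re w ≥ 1/4`, `|Γ'| ≤ 16` for
  `1/2 ≤ Re w ≤ 7/4` by the Cauchy estimate, `|Γ(1+i)| > 1/2` from `|Γ(1+i)|² = π/sinh π`);
* `norm_abelTwisted_sub_model_le` — the two-term model of §4 (24)–(25) on the box, from the exact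
  smoothed Perron formula (`abel_twisted_eq`, kernel `Γ(w) = Γ(w+1)/w`), the piece decomposition of the
  line (`kernel_integral_eq_sum_gpieces`, factor `η̃(u) = Γ(α + 1 + iu)`), the line estimate
  (`norm_lineIntegral_sub_model_le`, `H = 16`) and the tails of the absolutely convergent kernel;
* `exists_abelTwisted_zeros` — the closing argument (`exists_zero_of_good`, `eventually_good` with `ρ ≡ 1`):
  hypothesis `hA` of `montgomery1983_smoothedRemark_of_twisted_zeros`.

## References

* [Montgomery1983] H. L. Montgomery, *Zeros of approximations to the zeta function*, Studies in Pure
  Mathematics (Turán memorial), Birkhäuser 1983, 497–506: §1 p. 498 (`A_N`), §2 (5), §4 (24)–(25).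
-/

noncomputable section

open Complex Set Filter Topology MeasureTheory intervalIntegral Asymptotics Metric
open Literature.Analysis.SpecialFunctions
open Literature.Analysis.SpecialFunctions.Complex (differentiableOn_Gamma_re_pos)
open Literature.NumberTheory.LFunctions (Real.Gamma_le_one_of_mem_Icc)
open scoped Interval

namespace Literature.Barriers.RiemannHypothesis

section Abel

/-! ## `Γ` in the strip -/

/-- `Γ(x) ≤ 1/x` for `0 < x ≤ 1` (`Γ(x) = Γ(x+1)/x` and `Γ ≤ 1` on `[1, 2]`,
`Literature.NumberTheory.LFunctions.Real.Gamma_le_one_of_mem_Icc`). [folklore] -/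
theorem Real.Gamma_le_one_div {x : ℝ} (h0 : 0 < x) (h1 : x ≤ 1) : Real.Gamma x ≤ 1 / x := by
  have h := Real.Gamma_add_one h0.ne'
  have hle : Real.Gamma (x + 1) ≤ 1 := Real.Gamma_le_one_of_mem_Icc (by linarith) (by linarith)
  rw [le_div_iff₀ h0]
  calc Real.Gamma x * x = Real.Gamma (x + 1) := by rw [h]; ring
    _ ≤ 1 := hle

/-- `|Γ(w)| ≤ 4` for `1/4 ≤ Re w ≤ 2`. [folklore] -/
theorem norm_Gamma_le_four {w : ℂ} (h1 : 1 / 4 ≤ w.re) (h2 : w.re ≤ 2) : ‖Gamma w‖ ≤ 4 := by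
  have hw : (w.re : ℂ) + w.im * I = w := re_add_im w
  have h := GammaVert.norm_Gamma_le_Gamma_re (x := w.re) (by linarith) w.im
  rw [hw] at h
  refine h.trans ?_
  rcases le_or_gt 1 w.re with h3 | h3
  · exact (Real.Gamma_le_one_of_mem_Icc h3 h2).trans (by norm_num)
  · calc Real.Gamma w.re ≤ 1 / w.re := Real.Gamma_le_one_div (by linarith) h3.le
      _ ≤ 4 := by rw [div_le_iff₀ (by linarith)]; linarith

/-- `|Γ(w)| ≤ 2` for `1/2 ≤ Re w ≤ 2`. [folklore] -/
theorem norm_Gamma_le_two {w : ℂ} (h1 : 1 / 2 ≤ w.re) (h2 : w.re ≤ 2) : ‖Gamma w‖ ≤ 2 := by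
  have hw : (w.re : ℂ) + w.im * I = w := re_add_im w
  have h := GammaVert.norm_Gamma_le_Gamma_re (x := w.re) (by linarith) w.im
  rw [hw] at h
  refine h.trans ?_
  rcases le_or_gt 1 w.re with h3 | h3
  · exact (Real.Gamma_le_one_of_mem_Icc h3 h2).trans (by norm_num)
  · calc Real.Gamma w.re ≤ 1 / w.re := Real.Gamma_le_one_div (by linarith) h3.le
      _ ≤ 2 := by rw [div_le_iff₀ (by linarith)]; linarith

/-- **Cauchy's estimate for `Γ'`**: `|Γ'(w)| ≤ 16` for `1/2 ≤ Re w ≤ 7/4` (radius `1/4`, `|Γ| ≤ 4` on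
the circle). [folklore] -/
theorem norm_deriv_Gamma_le {w : ℂ} (h1 : 1 / 2 ≤ w.re) (h2 : w.re ≤ 7 / 4) : ‖deriv Gamma w‖ ≤ 16 := by
  have hre : ∀ z : ℂ, ‖z - w‖ ≤ 1 / 4 → 1 / 4 ≤ z.re ∧ z.re ≤ 2 := by
    intro z hz
    have := abs_re_le_norm (z - w)
    rw [sub_re] at this
    have := (abs_le.1 (this.trans hz))
    constructor <;> linarith [this.1, this.2]
  have hsub : closedBall w (1 / 4) ⊆ {z : ℂ | 0 < z.re} := fun z hz ↦ by
    rw [mem_closedBall, dist_eq_norm] at hz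
    simp only [mem_setOf_eq]; linarith [(hre z hz).1]
  have hd : DiffContOnCl ℂ Gamma (ball w (1 / 4)) := differentiableOn_Gamma_re_pos.diffContOnCl_ball hsub
  have h := Complex.norm_deriv_le_of_forall_mem_sphere_norm_le (by norm_num : (0 : ℝ) < 1 / 4) hd (C := 4)
    (fun z hz ↦ ?_)
  · calc ‖deriv Gamma w‖ ≤ 4 / (1 / 4) := h
      _ = 16 := by norm_num
  · rw [mem_sphere, dist_eq_norm] at hz
    obtain ⟨hz1, hz2⟩ := hre z hz.le
    exact norm_Gamma_le_four hz1 hz2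

/-- `Γ'` is continuous along the line `Re w = a > 0`. [folklore] -/
theorem continuous_deriv_Gamma_line {a : ℝ} (ha : 0 < a) :
    Continuous fun u : ℝ ↦ deriv Gamma ((a : ℂ) + u * I) := by
  have hopen : IsOpen {w : ℂ | 0 < w.re} := isOpen_lt continuous_const Complex.continuous_re
  have han : AnalyticOnNhd ℂ Gamma {w : ℂ | 0 < w.re} := differentiableOn_Gamma_re_pos.analyticOnNhd hopen
  exact han.deriv.continuousOn.comp_continuous (by fun_prop) (fun u ↦ by simp [ha])

/-- **`Γ` is `16`-Lipschitz on `1/2 ≤ Re w ≤ 7/4`.** [folklore] -/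
theorem norm_Gamma_sub_le {w w' : ℂ} (h1 : 1 / 2 ≤ w.re) (h2 : w.re ≤ 7 / 4) (h1' : 1 / 2 ≤ w'.re)
    (h2' : w'.re ≤ 7 / 4) : ‖Gamma w - Gamma w'‖ ≤ 16 * ‖w - w'‖ := by
  set W : Set ℂ := {z : ℂ | 1 / 2 ≤ z.re} ∩ {z : ℂ | z.re ≤ 7 / 4}
  have hW : Convex ℝ W := (convex_halfSpace_re_ge (r := 1 / 2)).inter (convex_halfSpace_re_le (r := 7 / 4))
  have hdiff : ∀ z ∈ W, DifferentiableAt ℂ Gamma z := fun z hz ↦ by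
    have hz1 : 1 / 2 ≤ z.re := hz.1
    exact differentiableOn_Gamma_re_pos.differentiableAt
      ((isOpen_lt continuous_const Complex.continuous_re).mem_nhds (by simp only [mem_setOf_eq]; linarith))
  have hbound : ∀ z ∈ W, ‖deriv Gamma z‖ ≤ 16 := fun z hz ↦ norm_deriv_Gamma_le hz.1 hz.2
  exact hW.norm_image_sub_le_of_norm_deriv_le hdiff hbound ⟨h1', h2'⟩ ⟨h1, h2⟩

/-- **`|Γ(1 + i)| > 1/2`** (`|Γ(1+i)|² = π/sinh π` and `sinh π < 12`). [folklore] -/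
theorem half_lt_norm_Gamma_one_add_I : 1 / 2 < ‖Gamma (1 + I)‖ := by
  have h := GammaVert.norm_sq_Gamma_one 1 one_ne_zero
  simp only [ofReal_one, one_mul, mul_one] at h
  -- `sinh π < 12`
  have he := Real.exp_one_lt_d9
  have hπ := Real.pi_lt_d2
  have hπ3 := Real.pi_gt_three
  have he3 : Real.exp 3 < 20.1 := by
    have h2 : Real.exp 2 < 7.3891 := by
      rw [show (2 : ℝ) = 1 + 1 by norm_num, Real.exp_add]; nlinarith [Real.exp_pos 1]
    rw [show (3 : ℝ) = 2 + 1 by norm_num, Real.exp_add]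
    have := mul_lt_mul'' h2 he (Real.exp_pos _).le (Real.exp_pos _).le
    linarith
  have he015 : Real.exp 0.15 ≤ 1 / 0.85 := by
    have h1 := Real.one_sub_le_exp_neg (0.15 : ℝ)
    rw [le_div_iff₀ (by norm_num)]
    calc Real.exp 0.15 * 0.85 ≤ Real.exp 0.15 * Real.exp (-0.15) := by
          refine mul_le_mul_of_nonneg_left ?_ (Real.exp_pos _).le; norm_num at h1 ⊢; exact h1
      _ = 1 := by rw [← Real.exp_add]; norm_num
  have hexpπ : Real.exp Real.pi < 24 := by
    calc Real.exp Real.pi ≤ Real.exp 3.15 := Real.exp_le_exp.2 hπ.le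
      _ = Real.exp 3 * Real.exp 0.15 := by rw [← Real.exp_add]; norm_num
      _ ≤ 20.1 * (1 / 0.85) := mul_le_mul he3.le he015 (Real.exp_pos _).le (by norm_num)
      _ < 24 := by norm_num
  have hsinh : Real.sinh Real.pi < 12 := by
    rw [Real.sinh_eq]; linarith [Real.exp_pos (-Real.pi)]
  have hsinhpos : 0 < Real.sinh Real.pi := Real.sinh_pos_iff.2 Real.pi_pos
  have hsq : 1 / 4 < ‖Gamma (1 + I)‖ ^ 2 := by
    rw [h, lt_div_iff₀ hsinhpos]; linarith
  refine lt_of_pow_lt_pow_left₀ 2 (norm_nonneg _) ?_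
  rw [show ((1 : ℝ) / 2) ^ 2 = 1 / 4 by norm_num]
  exact hsq

/-! ## The Abel-smoothed twisted series and its frozen kernel factor -/

variable (m : ℕ)

/-- The Abel-smoothed twisted series `P_N(s) = Σ_n e^{−n/N} a(n) n^{−s}` (an everywhere absolutely convergent
Dirichlet series). [cite: Montgomery1983, §1 p. 498 and §2 (3)] -/
def abelTwisted (N : ℕ) (s : ℂ) : ℂ :=
  LSeries (fun n ↦ ((Real.exp (-1 / (N : ℝ)) : ℝ) : ℂ) ^ n * montgomeryTwist m n) s

/-- The frozen kernel factor of the Abel model: `q_A(s) = Γ(2 + 1/Λ + i − s)/(1 + 1/Λ + i − s)` (the kernel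
`Γ(w) = Γ(w+1)/w` at the singularity `w = 1 + 1/Λ + i − s` of the first mode). [cite: Montgomery1983, §4 (24)] -/
def abelQ (Λ : ℝ) (s : ℂ) : ℂ := Gamma (zline Λ 1 - s + 1) / (zline Λ 1 - s)

/-- The coefficients `e^{−n/N} a(n)` are bounded by `1`. [folklore] -/
theorem norm_abelCoeff_le (N n : ℕ) : ‖((Real.exp (-1 / (N : ℝ)) : ℝ) : ℂ) ^ n * montgomeryTwist m n‖ ≤ 1 := by
  rw [norm_mul, norm_pow, norm_real, Real.norm_eq_abs, abs_of_pos (Real.exp_pos _)]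
  refine mul_le_one₀ (pow_le_one₀ (Real.exp_pos _).le ?_) (norm_nonneg _) (norm_montgomeryTwist_le_one m n)
  rw [Real.exp_le_one_iff]
  exact div_nonpos_of_nonpos_of_nonneg (by norm_num) (Nat.cast_nonneg N)

/-- `P_N` is holomorphic on `Re s > 1` (indeed entire; only this is used). [folklore] -/
theorem differentiableOn_abelTwisted (N : ℕ) : DifferentiableOn ℂ (abelTwisted m N) {s : ℂ | 1 < s.re} := by
  have habs : LSeries.abscissaOfAbsConv (fun n ↦ ((Real.exp (-1 / (N : ℝ)) : ℝ) : ℂ) ^ n * montgomeryTwist m n) ≤ (1 : ℝ) :=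
    LSeries.abscissaOfAbsConv_le_of_forall_lt_LSeriesSummable fun y hy ↦
      LSeriesSummable_of_bounded_of_one_lt_re (m := 1) (fun n _ ↦ norm_abelCoeff_le m N n) (by simpa using hy)
  refine (LSeries_differentiableOn _).mono fun s hs ↦ ?_
  exact lt_of_le_of_lt habs (by exact_mod_cast hs)

/-- **The frozen factor `q_A` on the box**: with `A = 1 + 1/Λ + i − s`, `B = A + 1` one has
`1/2 ≤ Re B ≤ 1`, `|B − (1+i)| ≤ 7/384`, hence `1/5 ≤ |Γ(B)| ≤ 2` and `1/10 ≤ |q_A| ≤ 3`; and `q_A` is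
`25`-Lipschitz there. [cite: Montgomery1983, §4 (24)–(25)] -/
theorem abelQ_modelBox {Λ c₁ c₂ : ℝ} (hΛ : 20 ≤ Λ) (hc₁ : 12 ≤ c₁ * Real.log Λ) (hc₁₂ : c₁ ≤ c₂)
    (hc₂ : c₂ * Real.log Λ + 6 ≤ Λ / 64) {s s' : ℂ}
    (hs : s ∈ modelBox Λ (1 + c₁ * Real.log Λ / Λ) (1 + c₂ * Real.log Λ / Λ))
    (hs' : s' ∈ modelBox Λ (1 + c₁ * Real.log Λ / Λ) (1 + c₂ * Real.log Λ / Λ)) :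
    (1 / 10 ≤ ‖abelQ Λ s‖ ∧ ‖abelQ Λ s‖ ≤ 3) ∧ ‖abelQ Λ s - abelQ Λ s'‖ ≤ 25 * ‖s - s'‖ := by
  have hΛ0 : 0 < Λ := by linarith
  have hc₂' : c₂ * Real.log Λ + 6 ≤ Λ / 2 := by linarith
  have hΛ384 : 384 ≤ Λ := by
    have hlog : 0 < Real.log Λ := Real.log_pos (by linarith)
    have : c₁ * Real.log Λ ≤ c₂ * Real.log Λ := mul_le_mul_of_nonneg_right hc₁₂ hlog.le
    linarith
  -- the pieces `A`, `B` for `s` and `s'`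
  have key : ∀ {z : ℂ}, z ∈ modelBox Λ (1 + c₁ * Real.log Λ / Λ) (1 + c₂ * Real.log Λ / Λ) →
      (3 / 4 ≤ ‖zline Λ 1 - z‖ ∧ ‖zline Λ 1 - z‖ ≤ 2) ∧
      (1 / 2 ≤ (zline Λ 1 - z + 1).re ∧ (zline Λ 1 - z + 1).re ≤ 7 / 4) ∧
      (1 / 5 ≤ ‖Gamma (zline Λ 1 - z + 1)‖ ∧ ‖Gamma (zline Λ 1 - z + 1)‖ ≤ 2) := by
    intro z hz
    obtain ⟨hA, -, -, -⟩ := cesaroQ_modelBox hΛ hc₁ hc₂' hz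
    obtain ⟨h1, h2, h3, -, h5, -⟩ := modelBox_basic hΛ hc₁ hc₂' hz
    have hBre : (zline Λ 1 - z + 1).re = 2 + 1 / Λ - z.re := by simp [zline]; ring
    have hre1 : 1 / 2 ≤ (zline Λ 1 - z + 1).re := by
      rw [hBre]; have := one_div_pos.2 hΛ0; linarith
    have hre2 : (zline Λ 1 - z + 1).re ≤ 1 := by
      rw [hBre]; have : 1 / Λ ≤ 11 / Λ := div_le_div_of_nonneg_right (by norm_num) hΛ0.le; linarith
    have hΓ2 : ‖Gamma (zline Λ 1 - z + 1)‖ ≤ 2 := norm_Gamma_le_two hre1 (by linarith)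
    -- `|B − (1 + i)| ≤ |z − 1| + 1/Λ ≤ 7/384`
    have hdist : ‖zline Λ 1 - z + 1 - (1 + I)‖ ≤ 7 / 384 := by
      have e : zline Λ 1 - z + 1 - (1 + I) = -(z - 1) + ((1 / Λ : ℝ) : ℂ) := by
        rw [zline]; push_cast; ring
      rw [e]
      calc ‖-(z - 1) + ((1 / Λ : ℝ) : ℂ)‖ ≤ ‖-(z - 1)‖ + ‖((1 / Λ : ℝ) : ℂ)‖ := norm_add_le _ _
        _ = ‖z - 1‖ + 1 / Λ := by
            rw [norm_neg, norm_real, Real.norm_eq_abs, abs_of_pos (one_div_pos.2 hΛ0)]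
        _ ≤ (c₂ * Real.log Λ + 6) / Λ + 1 / Λ := add_le_add h5 le_rfl
        _ ≤ 1 / 64 + 1 / 384 := by
            refine add_le_add ?_ (one_div_le_one_div_of_le (by norm_num) hΛ384)
            rw [div_le_iff₀ hΛ0]; linarith
        _ = 7 / 384 := by norm_num
    have hΓlo : 1 / 5 ≤ ‖Gamma (zline Λ 1 - z + 1)‖ := by
      have hL := norm_Gamma_sub_le (w := zline Λ 1 - z + 1) (w' := 1 + I) hre1 (by linarith)
        (by norm_num) (by norm_num)
      have h1i := half_lt_norm_Gamma_one_add_I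
      have := norm_sub_norm_le (Gamma (1 + I)) (Gamma (zline Λ 1 - z + 1))
      rw [norm_sub_rev] at this
      linarith
    exact ⟨hA, ⟨hre1, by linarith⟩, hΓlo, hΓ2⟩
  obtain ⟨⟨hA1, hA2⟩, ⟨hB1, hB2⟩, hΓ1, hΓ2⟩ := key hs
  obtain ⟨⟨hA1', hA2'⟩, ⟨hB1', hB2'⟩, hΓ1', hΓ2'⟩ := key hs'
  set A := zline Λ 1 - s with hAdef
  set A' := zline Λ 1 - s' with hA'def
  have hA0 : A ≠ 0 := norm_pos_iff.1 (by linarith)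
  have hA0' : A' ≠ 0 := norm_pos_iff.1 (by linarith)
  refine ⟨⟨?_, ?_⟩, ?_⟩
  · rw [abelQ, norm_div, le_div_iff₀ (by linarith)]; nlinarith
  · rw [abelQ, norm_div, div_le_iff₀ (by linarith)]; nlinarith
  · have hdiff : abelQ Λ s - abelQ Λ s' =
        (Gamma (A + 1) - Gamma (A' + 1)) / A + Gamma (A' + 1) * (s - s') / (A * A') := by
      simp only [abelQ, ← hAdef, ← hA'def]
      have hAA : A' - A = s - s' := by rw [hAdef, hA'def]; ring
      field_simp
      rw [← hAA]; ring
    have hL : ‖Gamma (A + 1) - Gamma (A' + 1)‖ ≤ 16 * ‖s - s'‖ := by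
      have h := norm_Gamma_sub_le hB1 hB2 hB1' hB2'
      rwa [show A + 1 - (A' + 1) = -(s - s') by rw [hAdef, hA'def]; ring, norm_neg] at h
    rw [hdiff]
    calc ‖(Gamma (A + 1) - Gamma (A' + 1)) / A + Gamma (A' + 1) * (s - s') / (A * A')‖
        ≤ ‖(Gamma (A + 1) - Gamma (A' + 1)) / A‖ + ‖Gamma (A' + 1) * (s - s') / (A * A')‖ := norm_add_le _ _
      _ = ‖Gamma (A + 1) - Gamma (A' + 1)‖ / ‖A‖ + ‖Gamma (A' + 1)‖ * ‖s - s'‖ / (‖A‖ * ‖A'‖) := by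
          rw [norm_div, norm_div, norm_mul, norm_mul]
      _ ≤ 16 * ‖s - s'‖ / (3 / 4) + 2 * ‖s - s'‖ / (3 / 4 * (3 / 4)) := by
          refine add_le_add ?_ ?_
          · exact div_le_div₀ (by positivity) hL (by norm_num) hA1
          · exact div_le_div₀ (by positivity) (mul_le_mul_of_nonneg_right hΓ2' (norm_nonneg _)) (by norm_num)
              (mul_le_mul hA1 hA1' (by norm_num) (norm_nonneg _))
      _ = (224 / 9) * ‖s - s'‖ := by ring
      _ ≤ 25 * ‖s - s'‖ := by linarith [norm_nonneg (s - s')]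

section ModelA

variable {A₁ A₂ A₃ A₄ : ℝ}
  (h18 : ∀ (k : ℤ) (z : ℂ), 1 < z.re → z.re ≤ 2 → |z.im - k| ≤ 1 / 2 →
    ‖montgomeryPhi m z + (montgomeryCoeff m k : ℂ) * log (z - 1 - k * I)‖ ≤
      A₁ + A₂ * Real.log (Real.log (|(k : ℝ)| + 5)))
  (h19 : ∀ (k : ℤ) (z : ℂ), 1 < z.re → z.re ≤ 2 → |z.im - k| ≤ 1 / 2 →
    ‖montgomeryPhiDeriv m z + (montgomeryCoeff m k : ℂ) / (z - 1 - k * I)‖ ≤ A₃ + A₄ * Real.log (|(k : ℝ)| + 5))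
include h18 h19

/-- **The two-term model for the Abel-smoothed twisted series.** Let `Λ = log N ≥ max(20, L₁²)`,
`1 + 11/Λ ≤ Re s ≤ 3/2`, `|Im s| ≤ 5/Λ`, `K₀ ≥ 1`. Then
`‖P_N(s) − f(s) − a₀ q_A(s) e^{−Λ(s−1)}‖ ≤ (e/2π)(lineErr(16, Λ, |α|/2, Λ^{-1/2}, K₀) + 2(Λ+1)/K₀) e^{−Λ(Re s−1)}`
((24)–(25) for `A_N`: the Cahen–Mellin formula (5) with the kernel `Γ(w) = Γ(w+1)/w`, the line cut into
pieces with the factor `Γ(α + 1 + iu)` (`|Γ| ≤ 2`, `|Γ'| ≤ 16` there), the tails `|w| > K₀` bounded through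
`|Γ(w)| ≤ Γ(Re w + 2)/(|w||w+1|)`). [cite: Montgomery1983, §2 (5), §4 (24)–(25)] -/
theorem norm_abelTwisted_sub_model_le (hA₂ : 0 ≤ A₂) (hA₃ : 0 ≤ A₃) (hA₄ : 0 ≤ A₄) {N : ℕ}
    (hΛ20 : 20 ≤ Real.log N) (hΛL : (A₃ + A₄ * Real.log 6) ^ 2 ≤ Real.log N) {s : ℂ}
    (hσ1 : 1 + 11 / Real.log N ≤ s.re) (hσ2 : s.re ≤ 3 / 2) (ht : |s.im| ≤ 5 / Real.log N)
    {K₀ : ℕ} (hK₀ : 1 ≤ K₀) :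
    ‖abelTwisted m N s - montgomeryF m s -
        (exp ((Real.log N : ℂ) * I) *
            ((Real.log N ^ (montgomeryCoeff m 1 - 1) / Real.Gamma (montgomeryCoeff m 1) : ℝ) : ℂ) *
            gOne m (Real.log N) 0) * abelQ (Real.log N) s * exp (-(Real.log N : ℂ) * (s - 1))‖ ≤
      Real.exp 1 / (2 * Real.pi) *
        (lineErr m A₁ A₂ A₃ A₄ 16 (Real.log N) (|1 + 1 / Real.log N - s.re| / 2)
            ((Real.log N) ^ (-(1 / 2 : ℝ))) K₀ + 2 * (Real.log N + 1) / K₀) *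
        Real.exp (-Real.log N * (s.re - 1)) := by
  set Λ := Real.log N with hΛdef
  have hΛ0 : 0 < Λ := by linarith
  have hN1 : 1 < (N : ℝ) := by
    by_contra h
    have := Real.log_nonpos (Nat.cast_nonneg N) (not_lt.1 h)
    linarith
  have hNpos : 0 < N := by exact_mod_cast (zero_lt_one.trans hN1)
  set x : ℝ := (N : ℝ) with hxdef
  have hx0 : 0 < x := by linarith
  have hxc : ((N : ℝ) : ℂ) = (N : ℂ) := by push_cast; rfl
  set σ := s.re with hσ
  set t := s.im with htdef
  set α : ℝ := 1 + 1 / Λ - σ with hα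
  have h11 : 11 / Λ ≤ σ - 1 := by linarith
  have hα0 : α < 0 := by
    rw [hα]; have : 1 / Λ < 11 / Λ := div_lt_div_of_pos_right (by norm_num) hΛ0; linarith
  have hα1 : -1 < α := by rw [hα]; have := one_div_pos.2 hΛ0; linarith
  have hα1' : 0 < α + 1 := by linarith
  have hσα : 1 < s.re + α := by rw [← hσ, hα]; have := one_div_pos.2 hΛ0; linarith
  have hre : ∀ u : ℝ, (s + α + u * I).re = 1 + 1 / Λ := by
    intro u; simp [← hσ, hα]
  have ht4 : |t| ≤ 1 / 4 := ht.trans (by rw [div_le_iff₀ hΛ0]; linarith)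
  -- (1) the exact smoothed Perron formula
  have hPerron := abel_twisted_eq (a := fun n ↦ montgomeryTwist m n) (norm_montgomeryTwist_le_one m)
    hα1 hα0 hσα hNpos
  -- the kernel and the integrand
  set κ : ℝ → ℂ := fun y ↦ Gamma ((α : ℂ) + y * I) with hκ
  set Ff : ℝ → ℂ := fun y ↦ montgomeryF m (s + α + y * I) * (x : ℂ) ^ ((α : ℂ) + y * I) with hFf
  set G : ℝ → ℂ := fun y ↦ Ff y * κ y with hG
  have hden1 : ∀ y : ℝ, (α : ℂ) + y * I ≠ 0 := fun y h ↦ by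
    have := congrArg Complex.re h; simp at this; exact hα0.ne this
  have hP : abelTwisted m N s = montgomeryF m s + (1 / (2 * Real.pi)) * ∫ y : ℝ, G y := by
    have h1 : (∫ y : ℝ, LSeries (fun n ↦ montgomeryTwist m n) (s + α + y * I) *
        (N : ℂ) ^ ((α : ℂ) + y * I) * Gamma ((α : ℂ) + y * I)) = ∫ y : ℝ, G y := by
      refine integral_congr_ae (Eventually.of_forall fun y ↦ ?_)
      simp only [hG, hFf, hκ, montgomeryF, hxdef, hxc]
    rw [abelTwisted, hPerron, h1]; rfl
  -- (2) sizes on the line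
  have hxα_norm : ∀ y : ℝ, ‖(x : ℂ) ^ ((α : ℂ) + y * I)‖ = x ^ α := fun y ↦
    Literature.NumberTheory.LFunctions.norm_cpow_line hx0 α y
  have hFf_le : ∀ y : ℝ, ‖Ff y‖ ≤ (Λ + 1) * x ^ α := by
    intro y
    simp only [hFf, norm_mul, hxα_norm]
    exact mul_le_mul_of_nonneg_right (norm_montgomeryF_le_of_re m hΛ0 (hre y)) (Real.rpow_nonneg hx0.le _)
  have hκ_le : ∀ y : ℝ, 1 ≤ |y| → ‖κ y‖ ≤ 1 / y ^ 2 := by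
    intro y hy
    have hy0 : 0 < |y| := by linarith
    have hA : |y| ≤ ‖(α : ℂ) + y * I‖ := by
      calc |y| = |((α : ℂ) + y * I).im| := by simp
        _ ≤ _ := abs_im_le_norm _
    have hB : |y| ≤ ‖(α : ℂ) + y * I + 1‖ := by
      calc |y| = |((α : ℂ) + y * I + 1).im| := by simp
        _ ≤ _ := abs_im_le_norm _
    have hreα : ((α : ℂ) + y * I).re = α := by simp
    have h := norm_Gamma_le_of_re_mem (w := (α : ℂ) + y * I) (by rw [hreα]; exact hα1) (by rw [hreα]; exact hα0)
    rw [hreα] at h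
    have hΓ1 : Real.Gamma (α + 2) ≤ 1 := Real.Gamma_le_one_of_mem_Icc (by linarith) (by linarith)
    simp only [hκ]
    refine h.trans ?_
    rw [show y ^ 2 = |y| * |y| by rw [← sq_abs]; ring]
    exact div_le_div₀ zero_le_one hΓ1 (mul_pos hy0 hy0) (mul_le_mul hA hB hy0.le (norm_nonneg _))
  -- continuity and integrability
  have hFf_cont : Continuous Ff := by
    have h1 : Continuous fun u : ℝ ↦ montgomeryF m (s + α + u * I) := by
      refine continuous_iff_continuousAt.2 fun u ↦ ?_
      have hd := differentiableAt_montgomeryF m (z := s + α + u * I) (by rw [hre]; linarith [one_div_pos.2 hΛ0])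
        (by rw [hre]; have : 1 / Λ ≤ 1 / 2 := one_div_le_one_div_of_le (by norm_num) (by linarith); linarith)
      exact hd.continuousAt.comp (f := fun u : ℝ ↦ s + α + u * I) (by fun_prop)
    have h2 : Continuous fun u : ℝ ↦ (x : ℂ) ^ ((α : ℂ) + u * I) := by
      simp_rw [ofReal_cpow_eq_exp hx0]; fun_prop
    simp only [hFf]; exact h1.mul h2
  have hκ_int : Integrable κ := integrable_Gamma_line hα1 hα0
  have hG_int : Integrable G := by
    simp only [hG]
    refine hκ_int.bdd_mul hFf_cont.aestronglyMeasurable (c := (Λ + 1) * x ^ α)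
      (Eventually.of_forall hFf_le)
  -- (3) tails
  set T₁ : ℝ := (K₀ : ℝ) + 1 / 2 - t with hT₁
  set T₂ : ℝ := (K₀ : ℝ) + 1 / 2 + t with hT₂
  have hK₀1 : (1 : ℝ) ≤ K₀ := by exact_mod_cast hK₀
  have hT₁K : (K₀ : ℝ) ≤ T₁ := by rw [hT₁]; linarith [(abs_le.1 ht4).2]
  have hT₂K : (K₀ : ℝ) ≤ T₂ := by rw [hT₂]; linarith [(abs_le.1 ht4).1]
  have htails : ‖(∫ y, G y) - ∫ y in (-T₂)..T₁, G y‖ ≤ 2 * ((Λ + 1) * x ^ α) / K₀ := by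
    have h := norm_integral_sub_intervalIntegral_le hG_int (C := (Λ + 1) * x ^ α) (hK₀1.trans hT₁K)
      (hK₀1.trans hT₂K) (fun u hu ↦ ?_)
    · refine h.trans ?_
      have hC0 : 0 ≤ (Λ + 1) * x ^ α := by positivity
      have hK₀pos : (0 : ℝ) < K₀ := by linarith
      calc (Λ + 1) * x ^ α / T₁ + (Λ + 1) * x ^ α / T₂ ≤ (Λ + 1) * x ^ α / K₀ + (Λ + 1) * x ^ α / K₀ :=
            add_le_add (div_le_div_of_nonneg_left hC0 hK₀pos hT₁K) (div_le_div_of_nonneg_left hC0 hK₀pos hT₂K)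
        _ = _ := by ring
    · simp only [hG, norm_mul]
      have hu0 : 0 < u ^ 2 := by
        have : 0 < |u| := by linarith
        rw [← sq_abs]; exact pow_pos this 2
      calc ‖Ff u‖ * ‖κ u‖ ≤ ((Λ + 1) * x ^ α) * (1 / u ^ 2) :=
            mul_le_mul (hFf_le u) (hκ_le u hu) (norm_nonneg _) (by positivity)
        _ = (Λ + 1) * x ^ α / u ^ 2 := by ring
  -- (4) the kernel factor `η̃(u) = Γ(α + iu + 1)`
  have hα12 : 1 / 2 ≤ α + 1 := by rw [hα]; have := one_div_pos.2 hΛ0; linarith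
  have hreB : ∀ u : ℝ, ((α : ℂ) + u * I + 1).re = α + 1 := fun u ↦ by simp
  have hopen : IsOpen {w : ℂ | 0 < w.re} := isOpen_lt continuous_const Complex.continuous_re
  set ηt : ℝ → ℂ := fun u ↦ Gamma ((α : ℂ) + u * I + 1) with hηt
  set ηt' : ℝ → ℂ := fun u ↦ deriv Gamma ((α : ℂ) + u * I + 1) * I with hηt'
  have hηd : ∀ u : ℝ, HasDerivAt ηt (ηt' u) u := by
    intro u
    have hh : HasDerivAt (fun u : ℝ ↦ (α : ℂ) + u * I + 1) I u := by
      simpa using ((((hasDerivAt_id (u : ℂ)).mul_const I).const_add (α : ℂ)).add_const (1 : ℂ)).comp_ofReal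
    have hΓ : DifferentiableAt ℂ Gamma ((α : ℂ) + u * I + 1) :=
      differentiableOn_Gamma_re_pos.differentiableAt (hopen.mem_nhds (by simp only [mem_setOf_eq, hreB]; linarith))
    have := hΓ.hasDerivAt.comp u hh
    simpa [hηt, hηt', Function.comp_def] using this
  have hηcont : Continuous ηt' := by
    have e : ηt' = fun u : ℝ ↦ deriv Gamma (((α + 1 : ℝ) : ℂ) + u * I) * I := by
      funext u; simp only [hηt']; congr 2; push_cast; ring
    rw [e]
    exact (continuous_deriv_Gamma_line (a := α + 1) hα1').mul continuous_const
  have hηt_cont : Continuous ηt := by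
    simp only [hηt]
    exact differentiableOn_Gamma_re_pos.continuousOn.comp_continuous (by fun_prop)
      (fun u ↦ by simp only [mem_setOf_eq, hreB]; linarith)
  have hηb : ∀ u : ℝ, ‖ηt u‖ ≤ 16 := fun u ↦
    (norm_Gamma_le_two (w := (α : ℂ) + u * I + 1) (by rw [hreB]; exact hα12) (by rw [hreB]; linarith)).trans
      (by norm_num)
  have hηb' : ∀ u : ℝ, ‖ηt' u‖ ≤ 16 := by
    intro u
    simp only [hηt', norm_mul, norm_I, mul_one]
    exact norm_deriv_Gamma_le (by rw [hreB]; exact hα12) (by rw [hreB]; linarith)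
  -- (5) the middle part as a sum of pieces
  have hmid_congr : ∫ y in (-T₂)..T₁, G y = ∫ u in (-T₂)..T₁,
      montgomeryF m (s + α + u * I) * (x : ℂ) ^ ((α : ℂ) + u * I) * (ηt u / ((α : ℂ) + u * I)) := by
    refine intervalIntegral.integral_congr fun u _ ↦ ?_
    simp only [hG, hFf, hκ, hηt]
    rw [Complex.Gamma_add_one _ (hden1 u)]
    field_simp [hden1 u]
  have hx1 : 1 < x := hN1
  have hx2 : 2 ≤ Real.log x := by rw [hxdef]; linarith
  have hσ' : s.re + α = 1 + 1 / Real.log x := by rw [← hσ, hα, hxdef]; ring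
  have hpieces := kernel_integral_eq_sum_gpieces m hx1 hx2 hσ' hα0.ne hηt_cont K₀
  rw [← hT₁, ← hT₂] at hpieces
  -- (6) the line estimate
  have hmodel := norm_lineIntegral_sub_model_le m h18 h19 hA₂ hA₃ hA₄ hx1 (by rwa [hxdef]) (by rwa [hxdef])
    (s := s) (by rwa [hxdef]) hσ2 (by rwa [hxdef]) (H := 16) (by norm_num) hηd hηcont hηb hηb' hK₀
  -- (7) identification of `q`
  have hd : (α : ℂ) + ((1 - t : ℝ) : ℂ) * I = zline Λ 1 - s := by
    rw [hα, zline, ← re_add_im s, ← hσ, ← htdef]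
    push_cast; ring
  have hq : ηt (1 - t) / (zline Λ 1 - s) = abelQ Λ s := by
    simp only [hηt]; rw [hd, abelQ]
  -- (8) assembling
  have hxα : x ^ α = Real.exp 1 * Real.exp (-Λ * (σ - 1)) := by
    rw [Real.rpow_def_of_pos hx0, ← hΛdef, ← Real.exp_add]
    congr 1; rw [hα]; field_simp; ring
  rw [← htdef] at hmodel hpieces
  rw [← hα, hq] at hmodel
  set S := ∑ i ∈ Finset.range (2 * K₀ + 1), ∫ v in (-(1 / 2))..(1 / 2),
    gpiece m Λ α t (fun v ↦ (x : ℂ) ^ (((((i : ℤ) - K₀ : ℤ) : ℝ) - t : ℝ) * I) *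
      ηt ((((i : ℤ) - K₀ : ℤ) : ℝ) + v - t)) ((i : ℤ) - K₀) v * exp (((Λ * v : ℝ) : ℂ) * I) with hS
  set A : ℂ := exp ((Λ : ℂ) * I) *
    ((Λ ^ (montgomeryCoeff m 1 - 1) / Real.Gamma (montgomeryCoeff m 1) : ℝ) : ℂ) * gOne m Λ 0 with hA
  set E : ℂ := exp (-(Λ : ℂ) * (s - 1)) with hE
  have hmid : (1 / (2 * (Real.pi : ℂ))) * ∫ y in (-T₂)..T₁, G y = (((x ^ α / (2 * Real.pi)) : ℝ) : ℂ) * S := by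
    rw [hmid_congr, hpieces, ← Complex.ofReal_cpow hx0.le]
    push_cast
    ring
  have hdecomp : abelTwisted m N s - montgomeryF m s - A * abelQ Λ s * E =
      (1 / (2 * (Real.pi : ℂ))) * ((∫ y, G y) - ∫ y in (-T₂)..T₁, G y) +
        ((((x ^ α / (2 * Real.pi)) : ℝ) : ℂ) * S - A * abelQ Λ s * E) := by
    rw [hP, ← hmid]; ring
  rw [hdecomp]
  have hnorm_coef : ‖(1 / (2 * (Real.pi : ℂ)))‖ = 1 / (2 * Real.pi) := by
    rw [show (1 / (2 * (Real.pi : ℂ))) = (((1 / (2 * Real.pi)) : ℝ) : ℂ) by push_cast; ring, norm_real,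
      Real.norm_eq_abs, abs_of_pos (by positivity)]
  calc ‖(1 / (2 * (Real.pi : ℂ))) * ((∫ y, G y) - ∫ y in (-T₂)..T₁, G y) +
        ((((x ^ α / (2 * Real.pi)) : ℝ) : ℂ) * S - A * abelQ Λ s * E)‖
      ≤ ‖(1 / (2 * (Real.pi : ℂ))) * ((∫ y, G y) - ∫ y in (-T₂)..T₁, G y)‖ +
          ‖(((x ^ α / (2 * Real.pi)) : ℝ) : ℂ) * S - A * abelQ Λ s * E‖ := norm_add_le _ _
    _ ≤ 1 / (2 * Real.pi) * (2 * ((Λ + 1) * x ^ α) / K₀) +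
          Real.exp 1 / (2 * Real.pi) * lineErr m A₁ A₂ A₃ A₄ 16 Λ (|α| / 2) (Λ ^ (-(1 / 2 : ℝ))) K₀ *
            Real.exp (-Λ * (σ - 1)) := by
        refine add_le_add ?_ hmodel
        rw [norm_mul, hnorm_coef]
        exact mul_le_mul_of_nonneg_left htails (by positivity)
    _ = _ := by rw [hxα]; ring


end ModelA

/-- **Abel-smoothed twisted zeros beyond `1 + c log log N/log N`** (hypothesis `hA` of
`montgomery1983_smoothedRemark_of_twisted_zeros`): for some `c > 0` and all large `N` there is a completely
multiplicative `ψ`, unimodular at the primes — Montgomery's `a(n)` for a suitable `δ` — and a zero `s₀` of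
`Σ_n e^{−n/N} ψ(n) n^{−s}` with `Re s₀ > 1 + c log log N/log N` (the Theorem of the source for `A_N`,
"mutatis mutandis"). [cite: Montgomery1983, §1 p. 498 and §4] -/
theorem exists_abelTwisted_zeros :
    ∃ c : ℝ, 0 < c ∧ ∃ N₀ : ℕ, ∀ N : ℕ, N₀ < N → ∃ ψ : ℕ → ℂ,
      (∀ m n : ℕ, m ≠ 0 → n ≠ 0 → ψ (m * n) = ψ m * ψ n) ∧ (∀ p : ℕ, p.Prime → ‖ψ p‖ = 1) ∧
      ∃ s₀ : ℂ, LSeries (fun n ↦ ((Real.exp (-1 / (N : ℝ)) : ℝ) : ℂ) ^ n * ψ n) s₀ = 0 ∧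
        1 + c * Real.log (Real.log N) / Real.log N < s₀.re := by
  obtain ⟨m, hm⟩ := exists_lt_montgomeryCoeff_one_sub_zero (c := 0) (by
    rw [lt_sub_iff_add_lt, zero_add, lt_div_iff₀ Real.pi_pos]; linarith [Real.pi_lt_four])
  obtain ⟨A₁, A₂, -, hA₂, h18⟩ := exists_norm_phi_add_log_le m
  obtain ⟨A₃, A₄, hA₃, hA₄, h19⟩ := exists_norm_phiDeriv_add_inv_le m
  obtain ⟨ε₁, hε₁, hev⟩ := eventually_good m (A₁ := A₁) hA₂ hA₃ hA₄ hm (H := 16) (q₀ := 1 / 10) (q₁ := 3)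
    (Lq := 25) (ρ₁ := 1) (ρ₂ := 1) (ρ₃ := 0) (by norm_num) (by norm_num) (by norm_num) one_pos one_pos le_rfl
  set cs := montgomeryCoeff m 1 - montgomeryCoeff m 0 - 1 with hcs
  have hlogN : Tendsto (fun N : ℕ ↦ Real.log (N : ℝ)) atTop atTop :=
    Real.tendsto_log_atTop.comp tendsto_natCast_atTop_atTop
  obtain ⟨N₀, hN₀⟩ := eventually_atTop.1 (hlogN.eventually hev)
  refine ⟨cs / 4, by rw [hcs]; linarith, N₀, fun N hN ↦ ⟨fun n ↦ montgomeryTwist m n,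
    fun a b _ _ ↦ montgomeryTwist_mul m a b, fun p hp ↦ norm_montgomeryTwist_prime m hp, ?_⟩⟩
  obtain ⟨g1, g2, g3, g4, g5, g6, g7, g8⟩ := hN₀ N hN.le
  set Λ := Real.log (N : ℝ) with hΛ
  have hΛ0 : 0 < Λ := by linarith
  have hc₁' : 12 ≤ cs / 2 * Real.log Λ := g3
  have hc₂' : (cs + 1) * Real.log Λ + 6 ≤ Λ / 2 := by linarith
  have hc₁₂ : cs / 2 ≤ cs + 1 := by linarith
  -- the model hypothesis, with the tails absorbed into `44 Λ^{-2}`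
  have hK₀1 : 1 ≤ ⌈Λ ^ 3⌉₊ := Nat.one_le_ceil_iff.2 (by positivity)
  have htail : 2 * (Λ + 1) / (⌈Λ ^ 3⌉₊ : ℕ) ≤ 44 * Λ ^ (-2 : ℝ) := by
    have hK : Λ ^ 3 ≤ ((⌈Λ ^ 3⌉₊ : ℕ) : ℝ) := Nat.le_ceil _
    have hKpos : (0 : ℝ) < ((⌈Λ ^ 3⌉₊ : ℕ) : ℝ) := by exact_mod_cast hK₀1
    rw [div_le_iff₀ hKpos]
    have h2 : Λ ^ (-2 : ℝ) * Λ ^ 3 = Λ := by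
      rw [show (Λ ^ 3 : ℝ) = Λ ^ (3 : ℝ) by norm_cast, ← Real.rpow_add hΛ0]; norm_num
    calc 2 * (Λ + 1) ≤ 44 * Λ := by linarith
      _ = 44 * Λ ^ (-2 : ℝ) * Λ ^ 3 := by rw [mul_assoc, h2]
      _ ≤ 44 * Λ ^ (-2 : ℝ) * ((⌈Λ ^ 3⌉₊ : ℕ) : ℝ) := mul_le_mul_of_nonneg_left hK (by positivity)
  have hmodel : ∀ s ∈ modelBox Λ (1 + cs / 2 * Real.log Λ / Λ) (1 + (cs + 1) * Real.log Λ / Λ),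
      ‖abelTwisted m N s - (fun _ : ℂ ↦ (1 : ℂ)) s * montgomeryF m s -
        (exp ((Λ : ℂ) * I) * ((Λ ^ (montgomeryCoeff m 1 - 1) / Real.Gamma (montgomeryCoeff m 1) : ℝ) : ℂ) *
          gOne m Λ 0) * abelQ Λ s * exp (-(Λ : ℂ) * (s - 1))‖ ≤
      Real.exp 1 / (2 * Real.pi) *
        (lineErr m A₁ A₂ A₃ A₄ 16 Λ (|1 + 1 / Λ - s.re| / 2) (Λ ^ (-(1 / 2 : ℝ))) ⌈Λ ^ 3⌉₊ + 44 * Λ ^ (-2 : ℝ)) *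
        Real.exp (-Λ * (s.re - 1)) := by
    intro s hs
    obtain ⟨h1, h2, h3, -⟩ := modelBox_basic g1 hc₁' hc₂' hs
    have hM := norm_abelTwisted_sub_model_le m h18 h19 hA₂ hA₃ hA₄ g1 g2 h1 h2 h3 hK₀1
    rw [one_mul]
    refine hM.trans (mul_le_mul_of_nonneg_right (mul_le_mul_of_nonneg_left (add_le_add le_rfl htail)
      (by positivity)) (Real.exp_pos _).le)
  have hF : DifferentiableOn ℂ (abelTwisted m N) (modelBox Λ (1 + cs / 2 * Real.log Λ / Λ)
      (1 + (cs + 1) * Real.log Λ / Λ)) := by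
    refine (differentiableOn_abelTwisted m N).mono fun s hs ↦ ?_
    obtain ⟨h1, -⟩ := modelBox_basic g1 hc₁' hc₂' hs
    simp only [mem_setOf_eq]; linarith [div_pos (by norm_num : (0:ℝ) < 11) hΛ0]
  obtain ⟨s, hs0, hsre⟩ := exists_zero_of_good m h18 h19 hm hε₁.le (by norm_num) (by norm_num) (by norm_num)
    one_pos le_rfl hF (differentiableOn_const 1) (fun s _ ↦ ⟨by simp, by simp, by simp⟩)
    (fun s hs ↦ (abelQ_modelBox g1 hc₁' hc₁₂ g4 hs hs).1)
    (fun s hs s' hs' ↦ (abelQ_modelBox g1 hc₁' hc₁₂ g4 hs hs').2) hmodel g1 g3 g4 g5 g6 g7 g8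
  refine ⟨s, hs0, lt_of_le_of_lt ?_ hsre⟩
  have h1 : 1 ≤ cs / 2 * Real.log Λ := by linarith
  rw [show cs / 4 * Real.log Λ / Λ = (cs / 2 * Real.log Λ / 2) / Λ by ring,
    show 1 + cs / 2 * Real.log Λ / Λ - 1 / (2 * Λ) = 1 + (cs / 2 * Real.log Λ - 1 / 2) / Λ by field_simp; ring]
  have : (cs / 2 * Real.log Λ / 2) / Λ ≤ (cs / 2 * Real.log Λ - 1 / 2) / Λ :=
    div_le_div_of_nonneg_right (by linarith) hΛ0.le
  linarith

end Abel

end Literature.Barriers.RiemannHypothesis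

end
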